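import Mathlib
import Literature.MathematicalPhysics.QuantumLattice.HubbardBandSectorCountingToolbox
import Literature.MathematicalPhysics.QuantumLattice.FermiRG.FST2Hypotheses
import Literature.MathematicalPhysics.QuantumLattice.HubbardScaleReport

/-!
# Lattice momenta in a thin shell `{|e| < η}` of a regular band: `#{k ∈ (ℤ/Lℤ)² : |e(2πk/L)| < η} ≤ C₁ η L² + C₂ L`

For a `C²` function `e` on the plane whose derivatives of order `≤ 2` are bounded by `K` and whose gradient has norm
`≥ g₀` on the shell `{|e| < r₀}` — the geometric constants `GeomConstants e K r₀ g₀ wmin` of Feldman–Salmhofer–Trubowitz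
(`FST2Hypotheses`; the curvature constant `wmin` is not used) — the number of momenta `p_k = 2πk/L`, `k ∈ (ℤ/Lℤ)²`, of the
discrete torus with `|e(p_k)| < η` (`0 < η ≤ r₀`) is at most `C₁·η·L² + C₂·L` for EVERY `L ≥ 1`, with the explicit constants
`C₁ = 8√2·(4√2·π·K/g₀ + 1)/(π·g₀)`, `C₂ = 4·(4√2·π·K/g₀ + 1)` (theorem
`card_torusSite_abs_lt_le_of_geomConstants`; centred representatives `torusCentredMomentum` for a `2πℤ²`-periodic `e`:
`card_torusSite_abs_centred_lt_le_of_geomConstants`).  This is the finite-volume counterpart of the continuum volume bound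
`vol{|e| < η} = O(η)` of a regular band (Feldman–Salmhofer–Trubowitz 1998 §2.2, Lemma 2.1 and the first step of App. B;
Salmhofer 1998 (5.19)): the `O(η L²)` bulk plus an `O(L)` boundary term, uniform in the side `L` — the form in which the
single-scale infrared Gram constants of lattice fermion expansions consume it (e.g. the Hubbard KL programme's scale-`0`
covariance bound, `Summits/HubbardSuperconductivity/…`, where `e = e_K` is the countertermed band of an admissible frame).

Route (elementary, [folklore]): at a counted point `‖∇e‖ ≥ g₀`, so one of the two partial derivatives is `≥ g₀/√2` in
absolute value; the points where `|∂ᵢe| ≥ g₀/√2` are counted along the `L` coordinate fibres in direction `i` with the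
one-dimensional grid count `gridCount_L2` of `HubbardBandSectorCountingToolbox` (`δ = η`, `λ = g₀/√2`, Lipschitz constant
`K` for `∂ᵢe` along the fibre from the global Hessian bound, spacing `2π/L`): each fibre carries at most
`(4√2πK/g₀ + 1)·(4√2·η·L/(π g₀) + 2)` such points; there are `2L` fibres.

Everything is proved; no definitions, no named facts; the one-dimensional and calculus helpers are `private`. [folklore]

## Mathlib / tree search

`lean search --decl 'card_.*(momentumShell|latticeMomentum|shell|level|sublevel|tube).*le'` and
`lean search 'card.*momentumShell|sublevel.*card'`: no lattice-point count of a thin shell in Mathlib or the tree (the tree's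
sector counts `count_pairs_exists` / `offsetSectorCount…` count sector TUPLES under momentum conservation; the continuum
statements are `FermiRG/FST2VolumeBoundLemmas.volume_regular_le_of_tiling_of_hessian_bound` and
`FermiRG/Salmhofer1998SublevelVolume`).  Used: the toolbox's `gridCount_L2` and `abs_sub_le_of_abs_deriv_le`
(`HubbardBandSectorCountingToolbox`), Mathlib's `iteratedFDeriv_one_apply`, `iteratedFDeriv_two_apply`, `inner_gradient_left`,
`EuclideanSpace.real_norm_sq_eq`, `Finset.card_le_card_of_injOn`, `self_sub_toIocDiv_zsmul`.

## References

* J. Feldman, M. Salmhofer, E. Trubowitz, *Perturbation theory around non-nested Fermi surfaces II. Regularity of the moving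
  Fermi surface: RPA contributions*, Comm. Pure Appl. Math. **51** (1998) 1133, §2.2 ((gzerinit), Lemma 2.1) and App. B
  (volume of thin shells of a regular band). [FeldmanSalmhoferTrubowitz1998]
* M. Salmhofer, *Continuous renormalization for fermions and Fermi liquid theory*, Comm. Math. Phys. **194** (1998) 249,
  (5.19)–(5.21) (the sublevel-volume estimate behind the propagator bounds). [Salmhofer1998]
-/

noncomputable section

namespace Literature.MathematicalPhysics.QuantumLattice

open Real Finset Set
open Literature.Probability.LatticeModels Literature.MathematicalPhysics.QuantumLattice.FermiRG
open Literature.MathematicalPhysics.QuantumLattice.BandSectorCounting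

/-! ### §1 One dimension: the grid count from a bound on the second derivative -/

/-- A bound `|g''| ≤ A` on the derivative of `g'` makes `g'` `A`-Lipschitz. [folklore] -/
private theorem abs_sub_le_mul_abs_sub_of_abs_deriv_le {g' g'' : ℝ → ℝ} (hg' : ∀ z, HasDerivAt g' (g'' z) z)
    {A : ℝ} (hbd : ∀ z, |g'' z| ≤ A) (z z' : ℝ) : |g' z - g' z'| ≤ A * |z - z'| := by
  rcases le_total z' z with h | h
  · have := abs_sub_le_of_abs_deriv_le hg' (x := z') (y := z) (fun t _ => hbd t) (z := z) ⟨h, le_rfl⟩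
    rwa [abs_of_nonneg (sub_nonneg.2 h)]
  · have := abs_sub_le_of_abs_deriv_le hg' (x := z) (y := z') (fun t _ => hbd t) (z := z') ⟨h, le_rfl⟩
    rw [abs_sub_comm, abs_sub_comm z z']
    rwa [abs_of_nonneg (sub_nonneg.2 h)]

/-- **(L2 count from a second-derivative bound)** `#{i < N : |g(xᵢ)| ≤ δ, |g'(xᵢ)| ≥ λ} ≤ (2ANw/λ + 1)·2(4δ/(λw) + 1)` for the
grid `xᵢ = x₀ + i w`, when `|g''| ≤ A` everywhere (the toolbox's `gridCount_L2` with the Lipschitz hypothesis discharged by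
the mean value theorem). [folklore] -/
private theorem gridCount_L2_of_abs_deriv_two_le {g g' g'' : ℝ → ℝ} (hg : ∀ z, HasDerivAt g (g' z) z)
    (hg' : ∀ z, HasDerivAt g' (g'' z) z) {A lam δ : ℝ} (hA : 0 < A) (hlam : 0 < lam) (hδ : 0 ≤ δ)
    (hbd : ∀ z, |g'' z| ≤ A) {x₀ w : ℝ} (hw : 0 < w) (N : ℕ) :
    ((((Finset.range N).filter fun i : ℕ =>
        |g (x₀ + i * w)| ≤ δ ∧ lam ≤ |g' (x₀ + i * w)|).card : ℝ)) ≤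
      (N * w / (lam / (2 * A)) + 1) * (2 * ((4 * δ / lam) / w + 1)) :=
  gridCount_L2 hg hA hlam hδ (abs_sub_le_mul_abs_sub_of_abs_deriv_le hg' hbd) hw N

/-! ### §2 Coordinate lines of a `C²` function on the plane -/

section Plane

variable {e : EuclideanSpace ℝ (Fin 2) → ℝ}

/-- Along the line `s ↦ c + s v`, `e` has derivative `De(c + t v)[v]`. [folklore] -/
private theorem hasDerivAt_comp_lineSeg (he : ContDiff ℝ 2 e) (c v : EuclideanSpace ℝ (Fin 2)) (t : ℝ) :
    HasDerivAt (fun s : ℝ => e (c + s • v)) (fderiv ℝ e (c + t • v) v) t := by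
  have hl : HasDerivAt (fun s : ℝ => c + s • v) v t := by
    simpa using ((hasDerivAt_id t).smul_const v).const_add c
  have hd : DifferentiableAt ℝ e (c + t • v) := (he.differentiable (by simp)).differentiableAt
  exact hd.hasFDerivAt.comp_hasDerivAt t hl

/-- Along the line `s ↦ c + s v`, `s ↦ De(c + s v)[v]` has derivative `D²e(c + t v)[v, v]`. [folklore] -/
private theorem hasDerivAt_fderiv_comp_lineSeg (he : ContDiff ℝ 2 e) (c v : EuclideanSpace ℝ (Fin 2)) (t : ℝ) :
    HasDerivAt (fun s : ℝ => fderiv ℝ e (c + s • v) v) (iteratedFDeriv ℝ 2 e (c + t • v) ![v, v]) t := by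
  have hl : HasDerivAt (fun s : ℝ => c + s • v) v t := by
    simpa using ((hasDerivAt_id t).smul_const v).const_add c
  have hd : DifferentiableAt ℝ (fderiv ℝ e) (c + t • v) :=
    ((he.fderiv_right (m := 1) le_rfl).differentiable one_ne_zero) _
  have h1 : HasDerivAt (fun s : ℝ => fderiv ℝ e (c + s • v)) (fderiv ℝ (fderiv ℝ e) (c + t • v) v) t :=
    hd.hasFDerivAt.comp_hasDerivAt t hl
  have h2 := h1.clm_apply (hasDerivAt_const t v)
  rw [iteratedFDeriv_two_apply]
  simpa using h2

/-- `|De(p)[v]| ≤ K` when `‖D¹e‖ ≤ K` and `‖v‖ = 1`. [folklore] -/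
private theorem abs_fderiv_apply_le_of_norm_iteratedFDeriv_le {K : ℝ} (p v : EuclideanSpace ℝ (Fin 2))
    (hK : ‖iteratedFDeriv ℝ 1 e p‖ ≤ K) (hv : ‖v‖ = 1) : |fderiv ℝ e p v| ≤ K := by
  have h1 : fderiv ℝ e p v = iteratedFDeriv ℝ 1 e p (fun _ => v) := by rw [iteratedFDeriv_one_apply]
  calc |fderiv ℝ e p v| = ‖iteratedFDeriv ℝ 1 e p (fun _ => v)‖ := by rw [h1, Real.norm_eq_abs]
    _ ≤ ‖iteratedFDeriv ℝ 1 e p‖ * ∏ i : Fin 1, ‖(fun _ : Fin 1 => v) i‖ :=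
        ContinuousMultilinearMap.le_opNorm _ _
    _ = ‖iteratedFDeriv ℝ 1 e p‖ := by simp [hv]
    _ ≤ K := hK

/-- `|D²e(p)[v, v]| ≤ K` when `‖D²e‖ ≤ K` and `‖v‖ = 1`. [folklore] -/
private theorem abs_iteratedFDeriv_two_apply_le_of_norm_le {K : ℝ} (p v : EuclideanSpace ℝ (Fin 2))
    (hK : ‖iteratedFDeriv ℝ 2 e p‖ ≤ K) (hv : ‖v‖ = 1) : |iteratedFDeriv ℝ 2 e p ![v, v]| ≤ K := by
  calc |iteratedFDeriv ℝ 2 e p ![v, v]| = ‖iteratedFDeriv ℝ 2 e p ![v, v]‖ := (Real.norm_eq_abs _).symm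
    _ ≤ ‖iteratedFDeriv ℝ 2 e p‖ * ∏ i : Fin 2, ‖(![v, v] : Fin 2 → EuclideanSpace ℝ (Fin 2)) i‖ :=
        ContinuousMultilinearMap.le_opNorm _ _
    _ = ‖iteratedFDeriv ℝ 2 e p‖ := by simp [Fin.prod_univ_two, hv]
    _ ≤ K := hK

/-- The partial derivative `De(p)[eᵢ]` is the `i`-th component of the gradient. [folklore] -/
private theorem fderiv_apply_single_eq_gradient_apply (p : EuclideanSpace ℝ (Fin 2)) (i : Fin 2) :
    fderiv ℝ e p (EuclideanSpace.single i 1) = gradient e p i := by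
  rw [← inner_gradient_left, EuclideanSpace.inner_single_right]
  simp

/-- If `‖∇e(p)‖ ≥ g₀ > 0` then one of the two partial derivatives is `≥ g₀/√2` in absolute value. [folklore] -/
private theorem exists_le_abs_fderiv_apply_single {g₀ : ℝ} (hg₀ : 0 < g₀) (p : EuclideanSpace ℝ (Fin 2))
    (h : g₀ ≤ ‖gradient e p‖) :
    g₀ / Real.sqrt 2 ≤ |fderiv ℝ e p (EuclideanSpace.single 0 1)| ∨
      g₀ / Real.sqrt 2 ≤ |fderiv ℝ e p (EuclideanSpace.single 1 1)| := by
  by_contra hcon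
  push Not at hcon
  obtain ⟨h0, h1⟩ := hcon
  rw [fderiv_apply_single_eq_gradient_apply] at h0 h1
  have hs : (g₀ / Real.sqrt 2) ^ 2 = g₀ ^ 2 / 2 := by
    rw [div_pow, Real.sq_sqrt (by norm_num)]
  have hsq : ‖gradient e p‖ ^ 2 = (gradient e p 0) ^ 2 + (gradient e p 1) ^ 2 := by
    rw [EuclideanSpace.real_norm_sq_eq, Fin.sum_univ_two]
  have hlt0 : (gradient e p 0) ^ 2 < g₀ ^ 2 / 2 := by
    rw [← hs, ← sq_abs]; exact pow_lt_pow_left₀ h0 (abs_nonneg _) two_ne_zero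
  have hlt1 : (gradient e p 1) ^ 2 < g₀ ^ 2 / 2 := by
    rw [← hs, ← sq_abs]; exact pow_lt_pow_left₀ h1 (abs_nonneg _) two_ne_zero
  have : g₀ ^ 2 ≤ ‖gradient e p‖ ^ 2 := pow_le_pow_left₀ hg₀.le h 2
  linarith

end Plane


/-! ### §3 The count on the momentum grid of the discrete torus -/

section Count

variable {e : EuclideanSpace ℝ (Fin 2) → ℝ}

/-- The torus momentum `p_k = 2πk/L ∈ [0, 2π)²` as a point of the plane: `(2πk₀/L)·e₀ + (2πk₁/L)·e₁`. [folklore] -/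
private theorem toLp_latticeMomentum_eq (L : ℕ) (k : TorusSite 2 L) :
    WithLp.toLp 2 (latticeMomentum L k) =
      (((k 0).val : ℝ) * (2 * π / L)) • EuclideanSpace.single (0 : Fin 2) (1 : ℝ) +
        (((k 1).val : ℝ) * (2 * π / L)) • EuclideanSpace.single (1 : Fin 2) (1 : ℝ) := by
  ext i
  fin_cases i <;> simp [latticeMomentum] <;> ring

/-- **Lattice momenta in a thin shell of a regular band.**  If `e ∈ C²(ℝ²)` has the geometric constants
`GeomConstants e K r₀ g₀ wmin` (derivatives of order `≤ 2` bounded by `K`; `‖∇e‖ ≥ g₀` on `{|e| < r₀}`), then for every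
side `L ≥ 1` and every `0 < η ≤ r₀` the number of torus momenta `p_k = 2πk/L`, `k ∈ (ℤ/Lℤ)²`, with `|e(p_k)| < η` is at most
`C₁·η·L² + C₂·L`, `C₁ = 8√2(4√2πK/g₀ + 1)/(πg₀)`, `C₂ = 4(4√2πK/g₀ + 1)` — the lattice reading of the regular-region
volume bound `vol{|e| < ε, |∇e| ≥ φ} ≤ Const·ε/φ` of Feldman–Salmhofer–Trubowitz (FST I App. A, quoted in FST II App. B) and of
Salmhofer's density-of-states constant `J₁` (1998, §2.2 p.7: `vol{|E| ≤ ε} ≤ 2J₁ε`).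
[cite: FeldmanSalmhoferTrubowitz1998, App. B (arXiv p.32 L92–97: regular-region volume bound R_δ(ε) ≤ Const·ε/φ(δ); finite-volume lattice reading)] -/
theorem card_torusSite_abs_lt_le_of_geomConstants (he : ContDiff ℝ 2 e) {K r₀ g₀ wmin : ℝ}
    (hG : GeomConstants e K r₀ g₀ wmin) (L : ℕ) [NeZero L] {η : ℝ} (hη : 0 < η) (hηr : η ≤ r₀) :
    (((Finset.univ.filter fun k : TorusSite 2 L =>
        |e (WithLp.toLp 2 (latticeMomentum L k))| < η).card : ℝ)) ≤
      8 * Real.sqrt 2 * (4 * Real.sqrt 2 * π * K / g₀ + 1) / (π * g₀) * η * (L : ℝ) ^ 2 +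
        4 * (4 * Real.sqrt 2 * π * K / g₀ + 1) * L := by
  classical
  -- notation
  set w : ℝ := 2 * π / L with hw_def
  set v₀ : EuclideanSpace ℝ (Fin 2) := EuclideanSpace.single (0 : Fin 2) (1 : ℝ) with hv₀_def
  set v₁ : EuclideanSpace ℝ (Fin 2) := EuclideanSpace.single (1 : Fin 2) (1 : ℝ) with hv₁_def
  set lam : ℝ := g₀ / Real.sqrt 2 with hlam_def
  set Q : ℝ := 4 * Real.sqrt 2 * π * K / g₀ + 1 with hQ_def
  have hLpos : (0 : ℝ) < L := Nat.cast_pos.2 (Nat.pos_of_ne_zero (NeZero.ne L))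
  have hg₀ : 0 < g₀ := hG.g₀_pos
  have hw : 0 < w := by rw [hw_def]; positivity
  have hs2 : 0 < Real.sqrt 2 := Real.sqrt_pos.2 two_pos
  have hlam : 0 < lam := div_pos hG.g₀_pos hs2
  have hv₀ : ‖v₀‖ = 1 := by rw [hv₀_def, PiLp.norm_single, norm_one]
  have hv₁ : ‖v₁‖ = 1 := by rw [hv₁_def, PiLp.norm_single, norm_one]
  have hK0 : 0 ≤ K := (norm_nonneg _).trans (hG.norm_iteratedFDeriv_le 0 0 (by norm_num))
  have hQ0 : 0 ≤ Q := by rw [hQ_def]; positivity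
  set S := Finset.univ.filter fun k : TorusSite 2 L => |e (WithLp.toLp 2 (latticeMomentum L k))| < η
    with hS_def
  -- the empty case (then nothing to count); otherwise `K > 0`
  rcases S.eq_empty_or_nonempty with hS0 | ⟨k₀, hk₀⟩
  · rw [hS0, Finset.card_empty, Nat.cast_zero]; positivity
  have hKpos : 0 < K := by
    rw [hS_def, Finset.mem_filter] at hk₀
    have hgrad := hG.le_norm_gradient _ (hk₀.2.trans_le hηr)
    rcases exists_le_abs_fderiv_apply_single hG.g₀_pos _ hgrad with h | h
    · exact hlam.trans_le (h.trans (abs_fderiv_apply_le_of_norm_iteratedFDeriv_le _ _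
        (hG.norm_iteratedFDeriv_le _ 1 (by norm_num)) hv₀))
    · exact hlam.trans_le (h.trans (abs_fderiv_apply_le_of_norm_iteratedFDeriv_le _ _
        (hG.norm_iteratedFDeriv_le _ 1 (by norm_num)) hv₁))
  -- fibre functions: direction `1` varies on the fibres `a` fixed, direction `0` on the fibres `b` fixed
  set G₁ : ℕ → ℝ → ℝ := fun a s => e (((a : ℝ) * w) • v₀ + s • v₁) with hG₁_def
  set G₁' : ℕ → ℝ → ℝ := fun a s => fderiv ℝ e (((a : ℝ) * w) • v₀ + s • v₁) v₁ with hG₁'_def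
  set G₁'' : ℕ → ℝ → ℝ := fun a s => iteratedFDeriv ℝ 2 e (((a : ℝ) * w) • v₀ + s • v₁) ![v₁, v₁] with hG₁''_def
  set G₀ : ℕ → ℝ → ℝ := fun b s => e (((b : ℝ) * w) • v₁ + s • v₀) with hG₀_def
  set G₀' : ℕ → ℝ → ℝ := fun b s => fderiv ℝ e (((b : ℝ) * w) • v₁ + s • v₀) v₀ with hG₀'_def
  set G₀'' : ℕ → ℝ → ℝ := fun b s => iteratedFDeriv ℝ 2 e (((b : ℝ) * w) • v₁ + s • v₀) ![v₀, v₀] with hG₀''_def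
  -- the per-fibre bound
  set B : ℝ := (L * w / (lam / (2 * K)) + 1) * (2 * ((4 * η / lam) / w + 1)) with hB_def
  have hfib₁ : ∀ a : ℕ, ((((Finset.range L).filter fun i : ℕ =>
      |G₁ a (0 + i * w)| ≤ η ∧ lam ≤ |G₁' a (0 + i * w)|).card : ℝ)) ≤ B := fun a =>
    gridCount_L2_of_abs_deriv_two_le (g := G₁ a) (g' := G₁' a) (g'' := G₁'' a)
      (fun z => hasDerivAt_comp_lineSeg he _ _ z) (fun z => hasDerivAt_fderiv_comp_lineSeg he _ _ z)
      hKpos hlam hη.le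
      (fun z => abs_iteratedFDeriv_two_apply_le_of_norm_le _ _ (hG.norm_iteratedFDeriv_le _ 2 le_rfl) hv₁)
      hw L
  have hfib₀ : ∀ b : ℕ, ((((Finset.range L).filter fun i : ℕ =>
      |G₀ b (0 + i * w)| ≤ η ∧ lam ≤ |G₀' b (0 + i * w)|).card : ℝ)) ≤ B := fun b =>
    gridCount_L2_of_abs_deriv_two_le (g := G₀ b) (g' := G₀' b) (g'' := G₀'' b)
      (fun z => hasDerivAt_comp_lineSeg he _ _ z) (fun z => hasDerivAt_fderiv_comp_lineSeg he _ _ z)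
      hKpos hlam hη.le
      (fun z => abs_iteratedFDeriv_two_apply_le_of_norm_le _ _ (hG.norm_iteratedFDeriv_le _ 2 le_rfl) hv₀)
      hw L
  -- the two index sets on `ℕ × ℕ`
  set T₁ := (Finset.range L ×ˢ Finset.range L).filter fun ab : ℕ × ℕ =>
      |G₁ ab.1 (0 + ab.2 * w)| ≤ η ∧ lam ≤ |G₁' ab.1 (0 + ab.2 * w)| with hT₁_def
  set T₀ := (Finset.range L ×ˢ Finset.range L).filter fun ab : ℕ × ℕ =>
      |G₀ ab.2 (0 + ab.1 * w)| ≤ η ∧ lam ≤ |G₀' ab.2 (0 + ab.1 * w)| with hT₀_def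
  have hT₁ : (T₁.card : ℝ) ≤ L * B := by
    have hc : T₁.card = ∑ a ∈ Finset.range L, ((Finset.range L).filter fun i : ℕ =>
        |G₁ a (0 + i * w)| ≤ η ∧ lam ≤ |G₁' a (0 + i * w)|).card := by
      rw [hT₁_def, Finset.card_filter, Finset.sum_product]
      refine Finset.sum_congr rfl fun a _ => ?_
      rw [Finset.card_filter]
    rw [hc]; push_cast
    calc ∑ a ∈ Finset.range L, ((((Finset.range L).filter fun i : ℕ =>
          |G₁ a (0 + i * w)| ≤ η ∧ lam ≤ |G₁' a (0 + i * w)|).card : ℝ))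
        ≤ ∑ a ∈ Finset.range L, B := Finset.sum_le_sum fun a _ => hfib₁ a
      _ = L * B := by rw [Finset.sum_const, Finset.card_range, nsmul_eq_mul]
  have hT₀ : (T₀.card : ℝ) ≤ L * B := by
    have hc : T₀.card = ∑ a ∈ Finset.range L, ((Finset.range L).filter fun b : ℕ =>
        |G₀ b (0 + a * w)| ≤ η ∧ lam ≤ |G₀' b (0 + a * w)|).card := by
      rw [hT₀_def, Finset.card_filter, Finset.sum_product]
      refine Finset.sum_congr rfl fun a _ => ?_
      rw [Finset.card_filter]
    -- swap the order of summation: count along the fibres `b` fixed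
    have hc' : T₀.card = ∑ b ∈ Finset.range L, ((Finset.range L).filter fun i : ℕ =>
        |G₀ b (0 + i * w)| ≤ η ∧ lam ≤ |G₀' b (0 + i * w)|).card := by
      rw [hT₀_def, Finset.card_filter, Finset.sum_product, Finset.sum_comm]
      refine Finset.sum_congr rfl fun b _ => ?_
      rw [Finset.card_filter]
    rw [hc']; push_cast
    calc ∑ b ∈ Finset.range L, ((((Finset.range L).filter fun i : ℕ =>
          |G₀ b (0 + i * w)| ≤ η ∧ lam ≤ |G₀' b (0 + i * w)|).card : ℝ))
        ≤ ∑ b ∈ Finset.range L, B := Finset.sum_le_sum fun b _ => hfib₀ b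
      _ = L * B := by rw [Finset.sum_const, Finset.card_range, nsmul_eq_mul]
  -- the index map and the covering `S ⊆ f⁻¹ T₀ ∪ f⁻¹ T₁`
  let f : TorusSite 2 L → ℕ × ℕ := fun k => ((k 0).val, (k 1).val)
  have hf_inj : Set.InjOn f Set.univ := by
    intro k _ k' _ hkk
    simp only [f, Prod.mk.injEq] at hkk
    funext i
    fin_cases i
    · exact ZMod.val_injective L hkk.1
    · exact ZMod.val_injective L hkk.2
  have hpt : ∀ k : TorusSite 2 L, WithLp.toLp 2 (latticeMomentum L k) =
      (((k 0).val : ℝ) * w) • v₀ + (((k 1).val : ℝ) * w) • v₁ := fun k => by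
    rw [hw_def, hv₀_def, hv₁_def]; exact toLp_latticeMomentum_eq L k
  set S₁ := S.filter fun k => lam ≤ |fderiv ℝ e (WithLp.toLp 2 (latticeMomentum L k)) v₁| with hS₁_def
  set S₀ := S.filter fun k => lam ≤ |fderiv ℝ e (WithLp.toLp 2 (latticeMomentum L k)) v₀| with hS₀_def
  have hcover : S ⊆ S₀ ∪ S₁ := by
    intro k hk
    have hk2 : |e (WithLp.toLp 2 (latticeMomentum L k))| < η := (Finset.mem_filter.1 hk).2
    have hgrad := hG.le_norm_gradient _ (hk2.trans_le hηr)
    rcases exists_le_abs_fderiv_apply_single hG.g₀_pos _ hgrad with h | h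
    · exact Finset.mem_union.2 (Or.inl (Finset.mem_filter.2 ⟨hk, h⟩))
    · exact Finset.mem_union.2 (Or.inr (Finset.mem_filter.2 ⟨hk, h⟩))
  have hS₁T : S₁.card ≤ T₁.card := by
    refine Finset.card_le_card_of_injOn f (fun k hk => ?_) (hf_inj.mono (Set.subset_univ _))
    rw [Finset.mem_coe, hS₁_def, Finset.mem_filter, hS_def, Finset.mem_filter] at hk
    rw [Finset.mem_coe, hT₁_def, Finset.mem_filter, Finset.mem_product, Finset.mem_range, Finset.mem_range]
    refine ⟨⟨ZMod.val_lt _, ZMod.val_lt _⟩, ?_, ?_⟩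
    · simp only [hG₁_def, f, zero_add, ← hpt k]; exact hk.1.2.le
    · simp only [hG₁'_def, f, zero_add, ← hpt k]; exact hk.2
  have hS₀T : S₀.card ≤ T₀.card := by
    refine Finset.card_le_card_of_injOn f (fun k hk => ?_) (hf_inj.mono (Set.subset_univ _))
    rw [Finset.mem_coe, hS₀_def, Finset.mem_filter, hS_def, Finset.mem_filter] at hk
    rw [Finset.mem_coe, hT₀_def, Finset.mem_filter, Finset.mem_product, Finset.mem_range, Finset.mem_range]
    have hpt' : WithLp.toLp 2 (latticeMomentum L k) = (((k 1).val : ℝ) * w) • v₁ + (((k 0).val : ℝ) * w) • v₀ := by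
      rw [hpt k, add_comm]
    refine ⟨⟨ZMod.val_lt _, ZMod.val_lt _⟩, ?_, ?_⟩
    · simp only [hG₀_def, f, zero_add, ← hpt']; exact hk.1.2.le
    · simp only [hG₀'_def, f, zero_add, ← hpt']; exact hk.2
  -- assemble
  have hcard : (S.card : ℝ) ≤ 2 * (L * B) := by
    have h1 : S.card ≤ S₀.card + S₁.card := (Finset.card_le_card hcover).trans (Finset.card_union_le _ _)
    have h2 : (S.card : ℝ) ≤ (T₀.card : ℝ) + (T₁.card : ℝ) := by exact_mod_cast h1.trans (add_le_add hS₀T hS₁T)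
    linarith
  -- arithmetic of the constants
  have hg₀ne : g₀ ≠ 0 := hG.g₀_pos.ne'
  have hLw : (L : ℝ) * w = 2 * π := by rw [hw_def]; field_simp
  have hB1 : (L : ℝ) * w / (lam / (2 * K)) + 1 = Q := by
    rw [hLw, hlam_def, hQ_def]; field_simp; ring
  have hB2 : 2 * ((4 * η / lam) / w + 1) = 4 * Real.sqrt 2 * η * L / (π * g₀) + 2 := by
    rw [hlam_def, hw_def]; field_simp
  have hB : B = Q * (4 * Real.sqrt 2 * η * L / (π * g₀) + 2) := by rw [hB_def, hB1, hB2]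
  calc (S.card : ℝ) ≤ 2 * (L * B) := hcard
    _ = 8 * Real.sqrt 2 * Q / (π * g₀) * η * (L : ℝ) ^ 2 + 4 * Q * L := by rw [hB]; field_simp; ring
    _ = _ := by rw [hQ_def]


/-- **The same count through the centred representatives** `torusCentredMomentum L k ∈ (-π, π]²` (`HubbardScaleReport`), for
a `2πℤ²`-periodic `e` — the form in which a band given on the Brillouin zone `[-π, π)²` is read on the torus momenta (e.g.
`nambuXiCT … = frameLevel … (toLp (torusCentredMomentum L k))` in the Hubbard KL programme).
[cite: FeldmanSalmhoferTrubowitz1998, App. B (arXiv p.32 L92–97: regular-region volume bound R_δ(ε) ≤ Const·ε/φ(δ); finite-volume lattice reading)] -/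
theorem card_torusSite_abs_centred_lt_le_of_geomConstants (he : ContDiff ℝ 2 e) {K r₀ g₀ wmin : ℝ}
    (hG : GeomConstants e K r₀ g₀ wmin)
    (hper : ∀ (q : Fin 2 → ℝ) (m : Fin 2 → ℤ),
      e (WithLp.toLp 2 (fun i => q i + 2 * π * m i)) = e (WithLp.toLp 2 q))
    (L : ℕ) [NeZero L] {η : ℝ} (hη : 0 < η) (hηr : η ≤ r₀) :
    (((Finset.univ.filter fun k : TorusSite 2 L =>
        |e (WithLp.toLp 2 (torusCentredMomentum L k))| < η).card : ℝ)) ≤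
      8 * Real.sqrt 2 * (4 * Real.sqrt 2 * π * K / g₀ + 1) / (π * g₀) * η * (L : ℝ) ^ 2 +
        4 * (4 * Real.sqrt 2 * π * K / g₀ + 1) * L := by
  have hpt : ∀ k : TorusSite 2 L,
      e (WithLp.toLp 2 (torusCentredMomentum L k)) = e (WithLp.toLp 2 (latticeMomentum L k)) := by
    intro k
    have hfun : torusCentredMomentum L k =
        fun i => latticeMomentum L k i + 2 * π * ((-toIocDiv Real.two_pi_pos (-π) (latticeMomentum L k i) : ℤ) : ℝ) := by
      funext i
      simp only [torusCentredMomentum]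
      rw [← self_sub_toIocDiv_zsmul Real.two_pi_pos (-π) (latticeMomentum L k i), zsmul_eq_mul]
      push_cast
      ring
    rw [hfun, hper]
  have hS : (Finset.univ.filter fun k : TorusSite 2 L => |e (WithLp.toLp 2 (torusCentredMomentum L k))| < η) =
      Finset.univ.filter fun k : TorusSite 2 L => |e (WithLp.toLp 2 (latticeMomentum L k))| < η :=
    Finset.filter_congr fun k _ => by rw [hpt k]
  rw [hS]
  exact card_torusSite_abs_lt_le_of_geomConstants he hG L hη hηr

end Count

end Literature.MathematicalPhysics.QuantumLattice
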